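import Summits.CriticalPhenomena.PercolationContinuityZ3.Theorems.PercNearOneGluingNoHeavyConstsSingleEdgeChainRule
import Summits.CriticalPhenomena.PercolationContinuityZ3.Theorems.PercNearOneGluingNoHeavyConstsSingleEdgeChainRuleSEE
import HarnessLib

/-!
# Under the single-edge chain rule, single-edge extremality holds at EVERY single-pair functional at the owner
# (PAPER-2 track (ii): constants of the CSH family)

builds on p205010 (kernel theorem, internal audit signed; external expert review pending).  Support file (`--supports
stmt-CriticalPhenomena-4575`), seat `prim-consts-2` (gen 3); rows A6/A11 of `run/shared/lean/prim/consts/CONSTANTS.md`; memo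
`run/shared/lean/prim/consts/FROM-prim-consts-2-g3-CHAIN-RULE.md` §1(C).  No definitions, no sorries; standard axioms.

* `Consts.SingleEdgeChainRule.see_pairOpen` — **CONDITIONAL THEOREM.**  Assume the typed conjecture `Consts.SingleEdgeChainRule`
  (`…ConstsSingleEdgeChainRule.lean`).  Then for every finite weighted graph on `Fin n` with weights `< 1`, owner `x`, pair `s(x,u)`
  (`u ≠ x`), observers `o, v` and avoided set `Y ∌ x, u, v`, the level-0 single-edge-extremality margin (the inequality of
  `Consts.SingleEdgeExtremal`) is nonnegative at `f = 1{s(x,u) ∈ 𝐂_x}` — i.e. the single-pair value `p⋆` is admissible against every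
  single-pair functional at the owner, whatever the weight of that pair (the pair `s(x,v)` itself gives equality, `Consts.covD_pairOpen_cross_eq`).
  This is `Consts.see_pairOpen_of_chainRule` fed with the conjecture at the pair-deleted weights.
[cite: VandenbergHaggstromKahn2005, Thm. 1.1 (pp. 3–5)]
-/

noncomputable section

namespace Summit.CriticalPhenomena.PercolationContinuityZ3.Theorems

open MeasureTheory Set Literature.Probability.LatticeModels Literature.Probability.Percolation
open scoped Classical

namespace Consts

/-- **Chain rule ⟹ SEE at every single-pair functional at the owner** (non-degenerate data: weights `< 1`, `u ≠ x`, `x, u, v ∉ Y`):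
under `Consts.SingleEdgeChainRule`, for `f = 1{s(x,u) ∈ 𝐂_x}`,
`covD(f, v) · [μ(D) μ(D₁ ∩ O) − μ(D₁) μ(D ∩ {x ↔ o})] ≤ covD(f, o) · [μ(D₁) μ(D ∩ {x ↮ v})]`
(`D = {x ↮ Y}`, `D₁ = D ∩ {v ↮ Y}`, `O = {x ↔ o} ∪ {v ↔ o}`). [cite: VandenbergHaggstromKahn2005, Thm. 1.1 (pp. 3–5)] -/
theorem SingleEdgeChainRule.see_pairOpen (hCR : SingleEdgeChainRule) {n : ℕ} (w : Sym2 (Fin n) → unitInterval)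
    (hw : ∀ d, w d < 1) (x u v o : Fin n) (Y : Set (Fin n)) (hxu : x ≠ u) (hx : x ∉ Y) (hu : u ∉ Y) (hv : v ∉ Y) :
    CSH.covD w x Y (fun C => if s(x, u) ∈ C then (1 : ℝ) else 0) v *
        ((prodBernoulli w).real {ω : BondConfig (Fin n) | ∀ y ∈ Y, ¬ (openGraph ω).Reachable x y} *
            (prodBernoulli w).real
              ({ω : BondConfig (Fin n) | ∀ y ∈ Y, ¬ (openGraph ω).Reachable x y ∧ ¬ (openGraph ω).Reachable v y} ∩
                (openConn x o ∪ openConn v o)) -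
          (prodBernoulli w).real
              {ω : BondConfig (Fin n) | ∀ y ∈ Y, ¬ (openGraph ω).Reachable x y ∧ ¬ (openGraph ω).Reachable v y} *
            (prodBernoulli w).real ({ω : BondConfig (Fin n) | ∀ y ∈ Y, ¬ (openGraph ω).Reachable x y} ∩ openConn x o)) ≤
      CSH.covD w x Y (fun C => if s(x, u) ∈ C then (1 : ℝ) else 0) o *
        ((prodBernoulli w).real
            {ω : BondConfig (Fin n) | ∀ y ∈ Y, ¬ (openGraph ω).Reachable x y ∧ ¬ (openGraph ω).Reachable v y} *
          (prodBernoulli w).real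
            ({ω : BondConfig (Fin n) | ∀ y ∈ Y, ¬ (openGraph ω).Reachable x y} ∩ {ω | ¬ (openGraph ω).Reachable x v})) :=
  see_pairOpen_of_chainRule w hw x u v o Y hxu hx hu hv
    (by convert hCR n (fun d => if d = s(x, u) then 0 else w d) x u v o Y)

end Consts

end Summit.CriticalPhenomena.PercolationContinuityZ3.Theorems

end
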